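import Literature.Analysis.Calculus.HardyExteriorDecay
import Literature.Geometry.Lorentzian.KerrDerivativeDecayHierarchy
import Mathlib.Analysis.Calculus.BumpFunction.InnerProduct
import HarnessLib

/-!
# DRSR Corollary 3.1, (31): the pointwise derivative decay from the *local* third-order energy
# decay, the second-order leaf energy decay (D2) and the a priori bounds (D3′)

(statement group **gr.S24**; namespace `Literature.Geometry.Lorentzian.Kerr`, glue in
`Literature.Geometry.Lorentzian`)

`KerrDerivativeDecayHierarchy.lean` proves the gr.S24 named fact
`Literature.Geometry.Lorentzian.drsr_wave_derivative_decay_kerr` (DRSR, arXiv:1402.7034, Cor. 3.1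
(31): `sup_{Σ̃_τ ∩ {r ≤ R}} |n_Σ̃ψ| + |∇_Σ̃ψ| ≤ C E τ^{-2+δ}`, in the Kerr–Schild coordinate form
`∑_μ (∂_μψ̃)²(τ, y) ≤ C τ^{-4+2δ}` on `{‖y‖ ≤ R}`) from the hypotheses (D) = (D1) ∧ (D2) ∧ (D3) of
the (30)-assembly applied to `ψ` and to `Tψ` and (D′) = (D4) ∧ (D5): decay `τ^{-4+2δ}` of the
**whole-leaf** third-order energy `∫_S ‖D³Ψ_τ‖²` and the a priori bound `‖y‖‖D²Ψ_τ‖ ≤ C₀` along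
each leaf out to `𝓘⁺`. The source is more economical: (31) is a statement on `{r ≤ R}`, and the
extra input beyond (30) is DRSR's *local* second estimate of Cor. 3.1 commuted once more
(`∫_{Σ̃_τ∩{r≤R}} J^N[N²ψ]-type ≤ C E τ^{-4+2δ}` with the elliptic estimate (29) of Thm. 3.2 at order
three; Moschidis, arXiv:1509.08489, §9.9, Cor. 9.2 with `m = 1`, where the Sobolev/Gagliardo–
Nirenberg step is performed on the region `{r ≤ R}` after cutting off). This file proves the
correspondingly **localised reduction**:

* `Kerr.exists_local_cutoff`: a smooth radial cut-off `χ` on `E3`, `χ = 1` on `{‖y‖ ≤ R₁ − 1}`,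
  `χ = 0` on `{‖y‖ ≥ R₁ − 1/2}`, with `‖Dχ‖, ‖D²χ‖ ≤ C` and `Dχ = D²χ = 0` off the shell.
* `Kerr.sq_le_of_localAgmon` (**the analytic core, proved**): for `|a| < M`,
  `R₁ ≥ R_af + 2` (`R_af = Kerr.afRadius a r₊`, beyond which `{‖y‖ > R_af}` lies in the slice
  `S = {r(0, ·) > r₊}`) there is `K = K(M, a, R₁)` such that every `g` smooth on `S` with
  `‖y‖|g| ≤ C₀` on `S` and `‖y‖‖Dg‖ ≤ C₀` on `S ∩ {‖y‖ < R₁}` satisfies, for `y ∈ S`,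
  `‖y‖ ≤ R₁ − 1`:
  `g(y)² ≤ K (√B₁ √(B₁ + B₂) + B₁ + B₂)`, `B₁ = ∫_S ‖Dg‖²`, `B₂ = ∫_{S ∩ {‖y‖ < R₁}} ‖D²g‖²`.
  Proof: the Agmon inequality of `KerrSliceAgmon.lean` (`Kerr.gagliardoNirenberg_slice`,
  `Φ² ≤ C_GN (√I₁ √I₂ + I₂)`) applied to the compactly supported `Φ = χ g`, whose a priori decay
  is trivial; `I₁ = ∫_S ‖D(χg)‖² ≤ 2B₁ + 2C² ∫_{shell} g²`, `I₂ = ∫_S ‖D²(χg)‖² ≤ 3B₂ + 12C²B₁ +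
  3C² ∫_{shell} g²` (Leibniz, `norm_iteratedFDerivWithin_mul_le`), and the first-order shell terms
  are controlled by the second-order energy through **Hardy's inequality with decay on
  `{‖y‖ > R₁ − 3/2} ⊆ S`** (`Literature.Analysis.Calculus.hardy_sq_lintegral_exterior_le_of_decay`,
  `HardyExteriorDecay.lean`): `∫_{shell} g² ≤ R₁² ∫_{‖y‖>R₁−3/2} g²/‖y‖² ≤ 4R₁² B₁`. This is where
  the decay `‖y‖|g| ≤ C₀` (the radiation field, (D3)) enters, and why the *whole-leaf* second-order
  energy (D2) is still needed while the third-order input localises.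
* `Kerr.drsr_corollary_3_1_scri_derivative_decay_of_localEnergy_decay` (**proved**): under the
  hypothesis (H) = (D2) ∧ (D3′) ∧ (L3) below, for `|a| < M` there is `R₀` such that for
  `R₁ ≥ R₀`, every admissible `ψ` with data in `{‖y‖ ≤ R₁}` and every `δ > 0` there is `C` with
  `(TΨ)_τ(y)² + ‖DΨ_τ(y)‖² ≤ C τ^{-4+2δ}` for `τ ≥ 1` and `y ∈ S`, `‖y‖ ≤ R₁ − 1` — applying the
  core to `g = (TΨ)_τ` and `g = ∂ᵢΨ_τ` (`Tψ` is admissible with the same ball data).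
* `Literature.Geometry.Lorentzian.drsr_wave_derivative_decay_kerr_of_localEnergy_decay`
  (**proved**): (H) ⟹ the named fact `drsr_wave_derivative_decay_kerr`, as in
  `KerrDerivativeDecayHierarchy.lean` (`R₁ = max(R₀, ρ, |R| + 1)`; on `{‖y‖ < R₁}` the leaf
  `Σ̃_τ(h♯_{R₁})` is the slice `{t* = τ}` and the left side is `coordEnergyDensity ψ (τ, y)`).

## The hypothesis (H) and what it replaces

For every admissible `ψ` with `HasBallData R₁` (`Ψ_τ = leafFun … ψ τ` along `Σ̃_τ(h♯_{R₁})`,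
`S = {r(0,·) > r₊}`):
(D2) `∀ δ > 0 ∃ C ∀ τ ≥ 1, leafHessEnergy ψ τ ≤ C τ^{-4+2δ}` — verbatim the second clause of (D)
(`KerrPointwiseDecayHierarchy.lean`; DRSR Cor. 3.1, second estimate / Moschidis Thm. 9.1, `q = 2`),
the remaining deep input of the (30)-chain;
(D3′) `∀ τ ≥ 1 ∃ C₀ ∀ y ∈ S, ‖y‖|Ψ_τ| ≤ C₀ ∧ ‖y‖‖DΨ_τ‖ ≤ C₀ ∧ (‖y‖ ≤ R₁ → ‖D²Ψ_τ(y)‖ ≤ C₀)` — (D3)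
plus the *qualitative, local* boundedness of the leaf Hessian on the compact part of the leaf
(where the leaf is the slice `{t* = τ} ∩ {‖y‖ ≤ R₁}`; for solutions smooth up to and across `𝓗⁺`
this is continuity; for the class `IsAdmissibleKerrWave`, smooth on the open exterior only, it is
part of the a priori input, exactly like (D3));
(L3) `∀ δ > 0 ∃ C ∀ τ ≥ 1, ∫_{S ∩ {‖y‖ < R₁}} (‖D³Ψ_τ‖² + ‖D²(TΨ)_τ‖²) dy ≤ C τ^{-4+2δ}` — the
**local** third-order improved energy decay: on `{‖y‖ < R₁}` the integrand is
`∑_{|α|=3} |∂^α_y ψ̃(τ,·)|² + ∑_{|α|=2}|∂^α_y ∂_{t*}ψ̃(τ,·)|²` up to constants, i.e. the square of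
the `H̊³ × H̊²` norm of `(ψ, n_Σψ)` on `Σ_τ ∩ {r ≲ R₁}`, which the elliptic estimate (29) of DRSR
Thm. 3.2 (`j = 3`) bounds by `∫_{Σ_τ} Σ_{i≤2} J^N[N^iψ] n`, whose local decay at the rate
`τ^{-4+2δ}` is the second estimate of Cor. 3.1 applied to `ψ` and its `N`-, `T`-commuted versions
(DRSR p. 14; Moschidis Thm. 9.1 with `q = 2`, `m = 1`).
Compared with `KerrDerivativeDecayHierarchy.lean`, (D1), (D2) for `Tψ`, the whole-leaf (D4) and
the decay clause (D5) at infinity are gone; what is asked of the far region is (D2) and (D3) only,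
as for (30). Hypothesis (H) asserts less than the sources (existential, `ψ`-dependent constants).

## References

* M. Dafermos, I. Rodnianski, Y. Shlapentokh-Rothman, *Decay for solutions of the wave equation
  on Kerr exterior spacetimes III: the full subextremal case `|a| < M`*, Ann. of Math. 183 (2016),
  arXiv:1402.7034: §3.3, Cor. 3.1 (31) and the second estimate, Thm. 3.2 (29), p. 14, p. 51,
  §4.3 (Hardy) (key `DafermosRodnianskiShlapentokhrothman2014`).
* G. Moschidis, arXiv:1509.08489 = Ann. PDE 2 (2016): §9.9 (proof of Cor. 9.2: cut-off to
  `{r ≤ R}` and Gagliardo–Nirenberg), Lemma 12.3 (Hardy on hyperboloids) (key `Moschidis2016`).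
-/

noncomputable section

open Set Filter MeasureTheory Metric TopologicalSpace Module
open scoped Topology ENNReal Manifold ContDiff

namespace Literature.Geometry.Lorentzian

namespace Kerr

/-! ### The cut-off at radius `R₁` -/

/-- **The local cut-off.** For `R₁ > 1` there is a smooth `χ : E3 → [0, 1]` with `χ = 1` on
`{‖y‖ ≤ R₁ − 1}`, `χ = 0` on `{‖y‖ ≥ R₁ − 1/2}`, whose first and second differentials are
bounded by one constant `C` and vanish off the shell `{R₁ − 1 ≤ ‖y‖ ≤ R₁ − 1/2}` (a bump
function). [folklore] -/
theorem exists_local_cutoff {R₁ : ℝ} (hR₁ : 1 < R₁) :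
    ∃ (χ : E3 → ℝ) (C : ℝ), 0 ≤ C ∧ ContDiff ℝ ∞ χ ∧ (∀ y, 0 ≤ χ y) ∧ (∀ y, χ y ≤ 1) ∧
      (∀ y : E3, ‖y‖ ≤ R₁ - 1 → χ y = 1) ∧ (∀ y : E3, R₁ - 1 / 2 ≤ ‖y‖ → χ y = 0) ∧
      (∀ y, ‖fderiv ℝ χ y‖ ≤ C) ∧ (∀ y, ‖iteratedFDeriv ℝ 2 χ y‖ ≤ C) ∧
      (∀ y : E3, (‖y‖ < R₁ - 1 ∨ R₁ - 1 / 2 < ‖y‖) →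
        fderiv ℝ χ y = 0 ∧ iteratedFDeriv ℝ 2 χ y = 0) := by
  let b : ContDiffBump (0 : E3) := ⟨R₁ - 1, R₁ - 1 / 2, by linarith, by linarith⟩
  have hb : ContDiff ℝ ∞ b := b.contDiff
  have hb2 : ContDiff ℝ 2 b := b.contDiff
  obtain ⟨C₁, hC₁⟩ := (hb2.continuous_fderiv two_ne_zero).bounded_above_of_compact_support
    (b.hasCompactSupport.fderiv (𝕜 := ℝ))
  obtain ⟨C₂, hC₂⟩ := (hb2.continuous_iteratedFDeriv (m := 2) le_rfl).bounded_above_of_compact_support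
    (b.hasCompactSupport.iteratedFDeriv 2)
  refine ⟨b, max (max C₁ C₂) 0, le_max_right _ _, hb, fun y ↦ b.nonneg' y, fun y ↦ b.le_one,
    fun y hy ↦ ?_, fun y hy ↦ ?_, fun y ↦ ?_, fun y ↦ ?_, fun y hy ↦ ?_⟩
  · exact b.one_of_mem_closedBall (by rwa [mem_closedBall_zero_iff])
  · exact b.zero_of_le_dist (by rwa [dist_zero_right])
  · exact (hC₁ y).trans ((le_max_left _ _).trans (le_max_left _ _))
  · exact (hC₂ y).trans ((le_max_right _ _).trans (le_max_left _ _))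
  · rcases hy with hy | hy
    · have hev : (b : E3 → ℝ) =ᶠ[𝓝 y] fun _ ↦ (1 : ℝ) :=
        b.eventuallyEq_one_of_mem_ball (by rwa [mem_ball_zero_iff])
      refine ⟨?_, ?_⟩
      · rw [hev.fderiv_eq]
        exact (hasFDerivAt_const (𝕜 := ℝ) (1 : ℝ) y).fderiv
      · rw [(hev.iteratedFDeriv ℝ 2).eq_of_nhds, iteratedFDeriv_const_of_ne two_ne_zero]
        rfl
    · have hy' : y ∉ tsupport (b : E3 → ℝ) := by
        rw [b.tsupport_eq, mem_closedBall_zero_iff, not_le]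
        exact hy
      refine ⟨fderiv_of_notMem_tsupport ℝ hy', ?_⟩
      exact Function.notMem_support.mp fun h ↦ hy' (support_iteratedFDeriv_subset 2 h)

/-! ### Leibniz bounds for the cut-off product -/

/-- First derivative of a product `χ g` at a point of an open set where `g` is smooth:
`‖D(χg)(y)‖ ≤ |χ(y)| ‖Dg(y)‖ + |g(y)| ‖Dχ(y)‖`. [folklore] -/
theorem norm_fderiv_mul_le {χ g : E3 → ℝ} {S : Set E3} (hS : IsOpen S) (hχ : ContDiff ℝ ∞ χ)
    (hg : ContDiffOn ℝ ∞ g S) {y : E3} (hy : y ∈ S) :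
    ‖fderiv ℝ (fun z ↦ χ z * g z) y‖ ≤ |χ y| * ‖fderiv ℝ g y‖ + |g y| * ‖fderiv ℝ χ y‖ := by
  have hgd : HasFDerivAt g (fderiv ℝ g y) y :=
    ((hg.contDiffAt (hS.mem_nhds hy)).differentiableAt (by simp)).hasFDerivAt
  have hχd : HasFDerivAt χ (fderiv ℝ χ y) y := ((hχ.differentiable (by simp)) y).hasFDerivAt
  have hprod : HasFDerivAt (fun z ↦ χ z * g z) (χ y • fderiv ℝ g y + g y • fderiv ℝ χ y) y :=
    hχd.mul hgd
  rw [hprod.fderiv]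
  calc ‖χ y • fderiv ℝ g y + g y • fderiv ℝ χ y‖
      ≤ ‖χ y • fderiv ℝ g y‖ + ‖g y • fderiv ℝ χ y‖ := norm_add_le _ _
    _ = |χ y| * ‖fderiv ℝ g y‖ + |g y| * ‖fderiv ℝ χ y‖ := by
        rw [norm_smul, norm_smul, Real.norm_eq_abs, Real.norm_eq_abs]

/-- Second derivative of a product `χ g` at a point of an open set where `g` is smooth (Leibniz,
`norm_iteratedFDerivWithin_mul_le` with `n = 2`):
`‖D²(χg)(y)‖ ≤ |χ(y)| ‖D²g(y)‖ + 2 ‖Dχ(y)‖ ‖Dg(y)‖ + ‖D²χ(y)‖ |g(y)|`. [folklore] -/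
theorem norm_fderiv_fderiv_mul_le {χ g : E3 → ℝ} {S : Set E3} (hS : IsOpen S)
    (hχ : ContDiff ℝ ∞ χ) (hg : ContDiffOn ℝ ∞ g S) {y : E3} (hy : y ∈ S) :
    ‖fderiv ℝ (fderiv ℝ (fun z ↦ χ z * g z)) y‖ ≤
      |χ y| * ‖fderiv ℝ (fderiv ℝ g) y‖ + 2 * ‖fderiv ℝ χ y‖ * ‖fderiv ℝ g y‖ +
        ‖iteratedFDeriv ℝ 2 χ y‖ * |g y| := by
  have hU : UniqueDiffOn ℝ S := hS.uniqueDiffOn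
  have h := norm_iteratedFDerivWithin_mul_le (𝕜 := ℝ) (n := 2) (N := ∞) hχ.contDiffOn hg hU hy
    (by norm_cast)
  have e : ∀ (f : E3 → ℝ) (n : ℕ), iteratedFDerivWithin ℝ n f S y = iteratedFDeriv ℝ n f y :=
    fun f n ↦ iteratedFDerivWithin_of_isOpen n hS hy
  simp only [Finset.sum_range_succ, Finset.sum_range_zero, zero_add, e] at h
  have h0χ : ‖iteratedFDeriv ℝ 0 χ y‖ = |χ y| := by rw [norm_iteratedFDeriv_zero, Real.norm_eq_abs]
  have h0g : ‖iteratedFDeriv ℝ 0 g y‖ = |g y| := by rw [norm_iteratedFDeriv_zero, Real.norm_eq_abs]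
  have h1χ : ‖iteratedFDeriv ℝ 1 χ y‖ = ‖fderiv ℝ χ y‖ := norm_iteratedFDeriv_one χ
  have h1g : ‖iteratedFDeriv ℝ 1 g y‖ = ‖fderiv ℝ g y‖ := norm_iteratedFDeriv_one g
  have h2g : ‖iteratedFDeriv ℝ 2 g y‖ = ‖fderiv ℝ (fderiv ℝ g) y‖ := norm_iteratedFDeriv_two_eq g y
  have h2p : ‖iteratedFDeriv ℝ 2 (fun z ↦ χ z * g z) y‖ =
      ‖fderiv ℝ (fderiv ℝ (fun z ↦ χ z * g z)) y‖ := norm_iteratedFDeriv_two_eq _ y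
  rw [h2p] at h
  refine h.trans (le_of_eq ?_)
  norm_num [Nat.choose, h0χ, h0g, h1χ, h1g, h2g]

/-! ### The analytic core: Agmon for the cut-off function, Hardy for the shell terms -/

set_option maxHeartbeats 800000 in
/-- **Local Agmon bound on the Kerr–Schild slice region via cut-off and Hardy.** For `|a| < M`
and `R₁ ≥ R_af + 2` (`R_af = Kerr.afRadius a r₊`) there is `K ≥ 0` such that for every
`g : E3 → ℝ` smooth on `S = {r(0,·) > r₊}` with `‖y‖|g(y)| ≤ C₀` on `S` and `‖y‖‖Dg(y)‖ ≤ C₀` on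
`S ∩ {‖y‖ < R₁}` (some `C₀`), and all `B₁, B₂ < ∞` with `∫_S ‖Dg‖² ≤ B₁`,
`∫_{S ∩ {‖y‖ < R₁}} ‖D²g‖² ≤ B₂`: for `y ∈ S` with `‖y‖ ≤ R₁ − 1`,
`g(y)² ≤ K (√B₁ √(B₁ + B₂) + (B₁ + B₂))`. Agmon's inequality (`Kerr.gagliardoNirenberg_slice`;
Moschidis arXiv:1509.08489 Lemma 9.10, §9.9) for `χ g` with the cut-off of `exists_local_cutoff`,
Leibniz, and Hardy's inequality with decay on `{‖y‖ > R₁ − 3/2} ⊆ S`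
(`Literature.Analysis.Calculus.hardy_sq_lintegral_exterior_le_of_decay`; DRSR §4.3) for the
first-order shell terms. [cite: Moschidis2016, §9.9 with Lemma 9.10 and Lemma 12.3; DafermosRodnianskiShlapentokhrothman2014 §4.3] -/
theorem sq_le_of_localAgmon :
    ∀ (M a : ℝ), IsSubextremal M a → ∀ R₁ : ℝ, afRadius a (rPlus M a) + 2 ≤ R₁ →
      ∃ K : ℝ, 0 ≤ K ∧ ∀ g : E3 → ℝ, ContDiffOn ℝ ∞ g (slice a (rPlus M a) : Set E3) →
        (∃ C₀ : ℝ, ∀ y ∈ (slice a (rPlus M a) : Set E3),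
            ‖y‖ * |g y| ≤ C₀ ∧ (‖y‖ < R₁ → ‖y‖ * ‖fderiv ℝ g y‖ ≤ C₀)) →
          ∀ B₁ B₂ : ℝ≥0∞,
            (∫⁻ y in (slice a (rPlus M a) : Set E3), ENNReal.ofReal (‖fderiv ℝ g y‖ ^ 2)) ≤ B₁ →
            (∫⁻ y in (slice a (rPlus M a) : Set E3) ∩ ball (0 : E3) R₁,
                ENNReal.ofReal (‖fderiv ℝ (fderiv ℝ g) y‖ ^ 2)) ≤ B₂ →
            B₁ < ⊤ → B₂ < ⊤ →
              ∀ y ∈ (slice a (rPlus M a) : Set E3), ‖y‖ ≤ R₁ - 1 →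
                g y ^ 2 ≤ K * (Real.sqrt B₁.toReal * Real.sqrt (B₁ + B₂).toReal +
                  (B₁ + B₂).toReal) := by
  intro M a hMa R₁ hR₁
  -- notation and the geometry of the radii
  set S : Set E3 := (slice a (rPlus M a) : Set E3) with hSdef
  have hSo : IsOpen S := (slice a (rPlus M a)).isOpen
  have hSm : MeasurableSet S := hSo.measurableSet
  have haf : 0 < afRadius a (rPlus M a) := afRadius_pos _ _
  have hR₁1 : 1 < R₁ := by linarith
  set R' : ℝ := R₁ - 1 / 2 with hR'
  set RH : ℝ := R₁ - 3 / 2 with hRH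
  have hRHpos : 0 < RH := by rw [hRH]; linarith
  have hR'pos : 0 < R' := by rw [hR']; linarith
  set H : Set E3 := {y | RH < ‖y‖} with hHdef
  have hHm : MeasurableSet H := (isOpen_lt continuous_const continuous_norm).measurableSet
  have hHS : H ⊆ S := fun y hy ↦ mem_slice_of_lt_norm (by
    have : RH < ‖y‖ := hy
    linarith)
  have hmemS : ∀ y : E3, R₁ - 2 < ‖y‖ → y ∈ S := fun y hy ↦ mem_slice_of_lt_norm (by linarith)
  -- the cut-off and the Agmon constant
  obtain ⟨χ, C, hC, hχs, hχnn, hχ1, hχone, hχzero, hDχ, hD2χ, hχoff⟩ := exists_local_cutoff hR₁1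
  obtain ⟨Cg, hCg, hGN⟩ := gagliardoNirenberg_slice M a hMa
  -- the constants
  set K₁ : ℝ := 2 + 8 * (C ^ 2 * R' ^ 2) with hK₁
  set K₃ : ℝ := 3 + 12 * C ^ 2 + 12 * (C ^ 2 * R' ^ 2) with hK₃
  have hK₁nn : 0 ≤ K₁ := by positivity
  have hK₃nn : 0 ≤ K₃ := by positivity
  refine ⟨Cg * (Real.sqrt K₁ * Real.sqrt K₃ + K₃), by positivity, ?_⟩
  intro g hg hdec B₁ B₂ hB₁ hB₂ hB₁top hB₂top y hyS hyR
  obtain ⟨C₀, hC₀⟩ := hdec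
  -- smoothness facts for `g` on `S`
  have hgAt : ∀ z ∈ S, ContDiffAt ℝ ∞ g z := fun z hz ↦ hg.contDiffAt (hSo.mem_nhds hz)
  have hgc : ContinuousOn g S := hg.continuousOn
  have hDgc : ContinuousOn (fderiv ℝ g) S := hg.continuousOn_fderiv_of_isOpen hSo (by simp)
  have hD2gc : ContinuousOn (fderiv ℝ (fderiv ℝ g)) S :=
    (hg.fderiv_of_isOpen hSo (m := ∞) (by simp)).continuousOn_fderiv_of_isOpen hSo (by simp)
  -- the shell estimate for a quantity `q` vanishing off the shell and bounded by `C` on it: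
  -- `g² q² ≤ C² R'² (g²/‖y‖²) 1_H`
  have hshell : ∀ (z : E3) (q : ℝ), 0 ≤ q → q ≤ C →
      ((‖z‖ < R₁ - 1 ∨ R₁ - 1 / 2 < ‖z‖) → q = 0) →
        g z ^ 2 * q ^ 2 ≤ C ^ 2 * R' ^ 2 * H.indicator (fun z ↦ g z ^ 2 / ‖z‖ ^ 2) z := by
    intro z q hq0 hqC hq
    by_cases hz : ‖z‖ < R₁ - 1 ∨ R₁ - 1 / 2 < ‖z‖
    · rw [hq hz]
      have h0 : 0 ≤ H.indicator (fun z ↦ g z ^ 2 / ‖z‖ ^ 2) z :=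
        indicator_nonneg (fun w _ ↦ by positivity) _
      have : 0 ≤ C ^ 2 * R' ^ 2 * H.indicator (fun z ↦ g z ^ 2 / ‖z‖ ^ 2) z :=
        mul_nonneg (by positivity) h0
      simpa using this
    · simp only [not_or, not_lt] at hz
      obtain ⟨hz1, hz2⟩ := hz
      have hzH : z ∈ H := by
        show RH < ‖z‖
        rw [hRH]; linarith
      have hzpos : 0 < ‖z‖ := by linarith
      rw [indicator_of_mem hzH]
      have hg2 : g z ^ 2 ≤ R' ^ 2 * (g z ^ 2 / ‖z‖ ^ 2) := by
        rw [mul_div_assoc', le_div_iff₀ (by positivity)]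
        have : ‖z‖ ^ 2 ≤ R' ^ 2 := pow_le_pow_left₀ (norm_nonneg _) (by rw [hR']; exact hz2) 2
        nlinarith [sq_nonneg (g z)]
      have hq2 : q ^ 2 ≤ C ^ 2 := pow_le_pow_left₀ hq0 hqC 2
      calc g z ^ 2 * q ^ 2 ≤ (R' ^ 2 * (g z ^ 2 / ‖z‖ ^ 2)) * C ^ 2 :=
            mul_le_mul hg2 hq2 (sq_nonneg _) (by positivity)
        _ = C ^ 2 * R' ^ 2 * (g z ^ 2 / ‖z‖ ^ 2) := by ring
  -- the cut-off product
  set Φ : E3 → ℝ := fun z ↦ χ z * g z with hΦ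
  have hΦreg : ContDiffOn ℝ ∞ Φ S := hχs.contDiffOn.mul hg
  -- Hardy with decay for `g` on `H ⊆ S`
  have hE : finrank ℝ E3 = 3 := finrank_euclideanSpace_fin
  have hHardy : (∫⁻ z in H, ENNReal.ofReal (g z ^ 2 / ‖z‖ ^ 2)) ≤ 4 * B₁ := by
    have h := Literature.Analysis.Calculus.hardy_sq_lintegral_exterior_le_of_decay hE
      (u := g) (R₀ := R₁ - 2) (R := RH) (C₀ := C₀) (by rw [hRH]; linarith) hRHpos
      (fun z hz ↦ (hgAt z (hmemS z hz)).of_le (by norm_cast))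
      (fun z hz ↦ (hC₀ z (hHS hz)).1)
    calc (∫⁻ z in H, ENNReal.ofReal (g z ^ 2 / ‖z‖ ^ 2))
        ≤ 4 * ∫⁻ z in H, ENNReal.ofReal (‖fderiv ℝ g z‖ ^ 2) := h
      _ ≤ 4 * B₁ := mul_le_mul' le_rfl ((lintegral_mono_set hHS).trans hB₁)
  -- the shell integral on `S`
  have hshell_int : (∫⁻ z in S, H.indicator (fun z ↦ ENNReal.ofReal (g z ^ 2 / ‖z‖ ^ 2)) z) ≤
      4 * B₁ := by
    rw [lintegral_indicator hHm, Measure.restrict_restrict hHm, inter_eq_left.mpr hHS]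
    exact hHardy
  have hind : ∀ z, ENNReal.ofReal (H.indicator (fun z ↦ g z ^ 2 / ‖z‖ ^ 2) z) =
      H.indicator (fun z ↦ ENNReal.ofReal (g z ^ 2 / ‖z‖ ^ 2)) z := by
    intro z
    by_cases hz : z ∈ H
    · rw [indicator_of_mem hz, indicator_of_mem hz]
    · rw [indicator_of_notMem hz, indicator_of_notMem hz, ENNReal.ofReal_zero]
  -- (I₁) the first integral
  have hDgm : AEMeasurable (fun z ↦ ENNReal.ofReal (‖fderiv ℝ g z‖ ^ 2)) (volume.restrict S) :=
    (ENNReal.continuous_ofReal.comp_continuousOn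
      ((continuous_pow 2).comp_continuousOn hDgc.norm)).aemeasurable hSm
  have hpt1 : ∀ z ∈ S, ENNReal.ofReal (‖fderiv ℝ Φ z‖ ^ 2) ≤
      2 * ENNReal.ofReal (‖fderiv ℝ g z‖ ^ 2) + ENNReal.ofReal (2 * (C ^ 2 * R' ^ 2)) *
        H.indicator (fun z ↦ ENNReal.ofReal (g z ^ 2 / ‖z‖ ^ 2)) z := by
    intro z hz
    have h1 := norm_fderiv_mul_le hSo hχs hg hz
    have hχz : |χ z| ≤ 1 := by rw [abs_of_nonneg (hχnn z)]; exact hχ1 z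
    have ha : |χ z| * ‖fderiv ℝ g z‖ ≤ ‖fderiv ℝ g z‖ :=
      mul_le_of_le_one_left (norm_nonneg _) hχz
    have hb : (|g z| * ‖fderiv ℝ χ z‖) ^ 2 ≤
        C ^ 2 * R' ^ 2 * H.indicator (fun z ↦ g z ^ 2 / ‖z‖ ^ 2) z := by
      rw [mul_pow, sq_abs]
      exact hshell z _ (norm_nonneg _) (hDχ z) (fun h ↦ by rw [(hχoff z h).1, norm_zero])
    have hsq : ‖fderiv ℝ Φ z‖ ^ 2 ≤ 2 * ‖fderiv ℝ g z‖ ^ 2 +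
        2 * (C ^ 2 * R' ^ 2) * H.indicator (fun z ↦ g z ^ 2 / ‖z‖ ^ 2) z := by
      calc ‖fderiv ℝ Φ z‖ ^ 2 ≤ (|χ z| * ‖fderiv ℝ g z‖ + |g z| * ‖fderiv ℝ χ z‖) ^ 2 :=
            pow_le_pow_left₀ (norm_nonneg _) h1 2
        _ ≤ 2 * (|χ z| * ‖fderiv ℝ g z‖) ^ 2 + 2 * (|g z| * ‖fderiv ℝ χ z‖) ^ 2 := by
            nlinarith [sq_nonneg (|χ z| * ‖fderiv ℝ g z‖ - |g z| * ‖fderiv ℝ χ z‖)]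
        _ ≤ 2 * ‖fderiv ℝ g z‖ ^ 2 + 2 * (C ^ 2 * R' ^ 2 *
              H.indicator (fun z ↦ g z ^ 2 / ‖z‖ ^ 2) z) :=
            add_le_add (mul_le_mul_of_nonneg_left
              (pow_le_pow_left₀ (by positivity) ha 2) zero_le_two)
              (mul_le_mul_of_nonneg_left hb zero_le_two)
        _ = _ := by ring
    have hnn1 : 0 ≤ 2 * ‖fderiv ℝ g z‖ ^ 2 := by positivity
    have hnn2 : 0 ≤ H.indicator (fun z ↦ g z ^ 2 / ‖z‖ ^ 2) z :=
      indicator_nonneg (fun w _ ↦ by positivity) _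
    calc ENNReal.ofReal (‖fderiv ℝ Φ z‖ ^ 2)
        ≤ ENNReal.ofReal (2 * ‖fderiv ℝ g z‖ ^ 2 +
            2 * (C ^ 2 * R' ^ 2) * H.indicator (fun z ↦ g z ^ 2 / ‖z‖ ^ 2) z) :=
          ENNReal.ofReal_le_ofReal hsq
      _ = _ := by
          rw [ENNReal.ofReal_add hnn1 (by positivity), ENNReal.ofReal_mul zero_le_two,
            ENNReal.ofReal_ofNat, ENNReal.ofReal_mul (by positivity), hind]
  have hI₁ : (∫⁻ z in S, ENNReal.ofReal (‖fderiv ℝ Φ z‖ ^ 2)) ≤ ENNReal.ofReal K₁ * B₁ := by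
    calc (∫⁻ z in S, ENNReal.ofReal (‖fderiv ℝ Φ z‖ ^ 2))
        ≤ ∫⁻ z in S, (2 * ENNReal.ofReal (‖fderiv ℝ g z‖ ^ 2) + ENNReal.ofReal (2 * (C ^ 2 * R' ^ 2)) *
            H.indicator (fun z ↦ ENNReal.ofReal (g z ^ 2 / ‖z‖ ^ 2)) z) := setLIntegral_mono' hSm hpt1
      _ = 2 * (∫⁻ z in S, ENNReal.ofReal (‖fderiv ℝ g z‖ ^ 2)) + ENNReal.ofReal (2 * (C ^ 2 * R' ^ 2)) *
            ∫⁻ z in S, H.indicator (fun z ↦ ENNReal.ofReal (g z ^ 2 / ‖z‖ ^ 2)) z := by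
          rw [lintegral_add_left' (hDgm.const_mul _), lintegral_const_mul' _ _ ENNReal.ofNat_ne_top,
            lintegral_const_mul' _ _ ENNReal.ofReal_ne_top]
      _ ≤ 2 * B₁ + ENNReal.ofReal (2 * (C ^ 2 * R' ^ 2)) * (4 * B₁) :=
          add_le_add (mul_le_mul' le_rfl hB₁) (mul_le_mul' le_rfl hshell_int)
      _ = ENNReal.ofReal K₁ * B₁ := by
          have h8 : ENNReal.ofReal (8 * (C ^ 2 * R' ^ 2)) =
              ENNReal.ofReal (2 * (C ^ 2 * R' ^ 2)) * 4 := by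
            rw [← ENNReal.ofReal_ofNat 4, ← ENNReal.ofReal_mul' (by norm_num)]
            congr 1
            ring
          have hK : ENNReal.ofReal K₁ = 2 + ENNReal.ofReal (2 * (C ^ 2 * R' ^ 2)) * 4 := by
            rw [hK₁, ENNReal.ofReal_add zero_le_two (by positivity), ENNReal.ofReal_ofNat, h8]
          rw [hK]
          ring
  -- (I₂) the second integral (only the first-order and shell terms need measurability)
  have hgm : AEMeasurable g (volume.restrict S) := hgc.aemeasurable hSm
  have hFm : AEMeasurable (H.indicator fun z ↦ ENNReal.ofReal (g z ^ 2 / ‖z‖ ^ 2))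
      (volume.restrict S) :=
    ((hgm.pow_const 2).div (measurable_norm.pow_const 2).aemeasurable).ennreal_ofReal.indicator
      hHm
  have hpt2 : ∀ z ∈ S, ENNReal.ofReal (‖fderiv ℝ (fderiv ℝ Φ) z‖ ^ 2) ≤
      3 * (ball (0 : E3) R₁).indicator
          (fun z ↦ ENNReal.ofReal (‖fderiv ℝ (fderiv ℝ g) z‖ ^ 2)) z +
        ENNReal.ofReal (12 * C ^ 2) * ENNReal.ofReal (‖fderiv ℝ g z‖ ^ 2) +
        ENNReal.ofReal (3 * (C ^ 2 * R' ^ 2)) *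
          H.indicator (fun z ↦ ENNReal.ofReal (g z ^ 2 / ‖z‖ ^ 2)) z := by
    intro z hz
    have h2 := norm_fderiv_fderiv_mul_le hSo hχs hg hz
    -- term a: `|χ| ‖D²g‖ ≤ 1_{ball R₁} ‖D²g‖`
    have ha : (|χ z| * ‖fderiv ℝ (fderiv ℝ g) z‖) ^ 2 ≤
        (ball (0 : E3) R₁).indicator (fun z ↦ ‖fderiv ℝ (fderiv ℝ g) z‖ ^ 2) z := by
      by_cases hzb : z ∈ ball (0 : E3) R₁
      · rw [indicator_of_mem hzb, mul_pow, sq_abs]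
        have : χ z ^ 2 ≤ 1 := by
          have h0 := hχnn z; have h1 := hχ1 z
          nlinarith
        nlinarith [sq_nonneg ‖fderiv ℝ (fderiv ℝ g) z‖]
      · rw [indicator_of_notMem hzb]
        have hzR : R₁ - 1 / 2 ≤ ‖z‖ := by
          rw [mem_ball_zero_iff, not_lt] at hzb
          linarith
        rw [hχzero z hzR]
        simp
    -- term b: `2 ‖Dχ‖ ‖Dg‖ ≤ 2 C ‖Dg‖`
    have hb : (2 * ‖fderiv ℝ χ z‖ * ‖fderiv ℝ g z‖) ^ 2 ≤ 4 * C ^ 2 * ‖fderiv ℝ g z‖ ^ 2 := by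
      have h1 : ‖fderiv ℝ χ z‖ ^ 2 ≤ C ^ 2 := pow_le_pow_left₀ (norm_nonneg _) (hDχ z) 2
      nlinarith [sq_nonneg ‖fderiv ℝ g z‖]
    -- term c: the shell term with `D²χ`
    have hc : (‖iteratedFDeriv ℝ 2 χ z‖ * |g z|) ^ 2 ≤
        C ^ 2 * R' ^ 2 * H.indicator (fun z ↦ g z ^ 2 / ‖z‖ ^ 2) z := by
      rw [mul_pow, sq_abs, mul_comm]
      exact hshell z _ (norm_nonneg _) (hD2χ z) (fun h ↦ by rw [(hχoff z h).2, norm_zero])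
    have hsq : ‖fderiv ℝ (fderiv ℝ Φ) z‖ ^ 2 ≤
        3 * (ball (0 : E3) R₁).indicator (fun z ↦ ‖fderiv ℝ (fderiv ℝ g) z‖ ^ 2) z +
          12 * C ^ 2 * ‖fderiv ℝ g z‖ ^ 2 +
          3 * (C ^ 2 * R' ^ 2) * H.indicator (fun z ↦ g z ^ 2 / ‖z‖ ^ 2) z := by
      have hnn : 0 ≤ |χ z| * ‖fderiv ℝ (fderiv ℝ g) z‖ + 2 * ‖fderiv ℝ χ z‖ * ‖fderiv ℝ g z‖ +
          ‖iteratedFDeriv ℝ 2 χ z‖ * |g z| := by positivity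
      calc ‖fderiv ℝ (fderiv ℝ Φ) z‖ ^ 2
          ≤ (|χ z| * ‖fderiv ℝ (fderiv ℝ g) z‖ + 2 * ‖fderiv ℝ χ z‖ * ‖fderiv ℝ g z‖ +
              ‖iteratedFDeriv ℝ 2 χ z‖ * |g z|) ^ 2 :=
            pow_le_pow_left₀ (ContinuousLinearMap.opNorm_nonneg _) h2 2
        _ ≤ 3 * ((|χ z| * ‖fderiv ℝ (fderiv ℝ g) z‖) ^ 2 + (2 * ‖fderiv ℝ χ z‖ * ‖fderiv ℝ g z‖) ^ 2 +
              (‖iteratedFDeriv ℝ 2 χ z‖ * |g z|) ^ 2) := by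
            nlinarith [sq_nonneg (|χ z| * ‖fderiv ℝ (fderiv ℝ g) z‖ -
                2 * ‖fderiv ℝ χ z‖ * ‖fderiv ℝ g z‖),
              sq_nonneg (2 * ‖fderiv ℝ χ z‖ * ‖fderiv ℝ g z‖ - ‖iteratedFDeriv ℝ 2 χ z‖ * |g z|),
              sq_nonneg (|χ z| * ‖fderiv ℝ (fderiv ℝ g) z‖ - ‖iteratedFDeriv ℝ 2 χ z‖ * |g z|)]
        _ ≤ 3 * ((ball (0 : E3) R₁).indicator (fun z ↦ ‖fderiv ℝ (fderiv ℝ g) z‖ ^ 2) z +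
              4 * C ^ 2 * ‖fderiv ℝ g z‖ ^ 2 +
              C ^ 2 * R' ^ 2 * H.indicator (fun z ↦ g z ^ 2 / ‖z‖ ^ 2) z) := by
            gcongr
        _ = _ := by ring
    have hnn1 : 0 ≤ (ball (0 : E3) R₁).indicator (fun z ↦ ‖fderiv ℝ (fderiv ℝ g) z‖ ^ 2) z :=
      indicator_nonneg (fun w _ ↦ by positivity) _
    have hnn2 : 0 ≤ H.indicator (fun z ↦ g z ^ 2 / ‖z‖ ^ 2) z :=
      indicator_nonneg (fun w _ ↦ by positivity) _
    have hind' : ENNReal.ofReal ((ball (0 : E3) R₁).indicator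
        (fun z ↦ ‖fderiv ℝ (fderiv ℝ g) z‖ ^ 2) z) =
        (ball (0 : E3) R₁).indicator (fun z ↦ ENNReal.ofReal (‖fderiv ℝ (fderiv ℝ g) z‖ ^ 2)) z := by
      by_cases hzb : z ∈ ball (0 : E3) R₁
      · rw [indicator_of_mem hzb, indicator_of_mem hzb]
      · rw [indicator_of_notMem hzb, indicator_of_notMem hzb, ENNReal.ofReal_zero]
    calc ENNReal.ofReal (‖fderiv ℝ (fderiv ℝ Φ) z‖ ^ 2)
        ≤ ENNReal.ofReal (3 * (ball (0 : E3) R₁).indicator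
            (fun z ↦ ‖fderiv ℝ (fderiv ℝ g) z‖ ^ 2) z + 12 * C ^ 2 * ‖fderiv ℝ g z‖ ^ 2 +
            3 * (C ^ 2 * R' ^ 2) * H.indicator (fun z ↦ g z ^ 2 / ‖z‖ ^ 2) z) :=
          ENNReal.ofReal_le_ofReal hsq
      _ = _ := by
          rw [ENNReal.ofReal_add (by positivity) (by positivity),
            ENNReal.ofReal_add (by positivity) (by positivity),
            ENNReal.ofReal_mul zero_le_three, ENNReal.ofReal_ofNat, hind',
            ENNReal.ofReal_mul (p := 12 * C ^ 2) (by positivity),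
            ENNReal.ofReal_mul (p := 3 * (C ^ 2 * R' ^ 2)) (by positivity), hind]
  have hI₂ : (∫⁻ z in S, ENNReal.ofReal (‖fderiv ℝ (fderiv ℝ Φ) z‖ ^ 2)) ≤
      ENNReal.ofReal K₃ * (B₁ + B₂) := by
    have hball : (∫⁻ z in S, (ball (0 : E3) R₁).indicator
        (fun z ↦ ENNReal.ofReal (‖fderiv ℝ (fderiv ℝ g) z‖ ^ 2)) z) ≤ B₂ := by
      rw [lintegral_indicator measurableSet_ball, Measure.restrict_restrict measurableSet_ball,
        inter_comm]
      exact hB₂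
    calc (∫⁻ z in S, ENNReal.ofReal (‖fderiv ℝ (fderiv ℝ Φ) z‖ ^ 2))
        ≤ ∫⁻ z in S, (3 * (ball (0 : E3) R₁).indicator
            (fun z ↦ ENNReal.ofReal (‖fderiv ℝ (fderiv ℝ g) z‖ ^ 2)) z +
            ENNReal.ofReal (12 * C ^ 2) * ENNReal.ofReal (‖fderiv ℝ g z‖ ^ 2) +
            ENNReal.ofReal (3 * (C ^ 2 * R' ^ 2)) *
              H.indicator (fun z ↦ ENNReal.ofReal (g z ^ 2 / ‖z‖ ^ 2)) z) :=
          setLIntegral_mono' hSm hpt2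
      _ = 3 * (∫⁻ z in S, (ball (0 : E3) R₁).indicator
              (fun z ↦ ENNReal.ofReal (‖fderiv ℝ (fderiv ℝ g) z‖ ^ 2)) z) +
            ENNReal.ofReal (12 * C ^ 2) * (∫⁻ z in S, ENNReal.ofReal (‖fderiv ℝ g z‖ ^ 2)) +
            ENNReal.ofReal (3 * (C ^ 2 * R' ^ 2)) *
              ∫⁻ z in S, H.indicator (fun z ↦ ENNReal.ofReal (g z ^ 2 / ‖z‖ ^ 2)) z := by
          rw [lintegral_add_right' _ (hFm.const_mul _), lintegral_add_right' _ (hDgm.const_mul _),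
            lintegral_const_mul' _ _ ENNReal.ofNat_ne_top,
            lintegral_const_mul' _ _ ENNReal.ofReal_ne_top,
            lintegral_const_mul' _ _ ENNReal.ofReal_ne_top]
      _ ≤ 3 * B₂ + ENNReal.ofReal (12 * C ^ 2) * B₁ + ENNReal.ofReal (3 * (C ^ 2 * R' ^ 2)) * (4 * B₁) :=
          add_le_add (add_le_add (mul_le_mul' le_rfl hball) (mul_le_mul' le_rfl hB₁))
            (mul_le_mul' le_rfl hshell_int)
      _ = 3 * B₂ + ENNReal.ofReal (12 * C ^ 2 + 12 * (C ^ 2 * R' ^ 2)) * B₁ := by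
          have h12 : ENNReal.ofReal (12 * (C ^ 2 * R' ^ 2)) =
              ENNReal.ofReal (3 * (C ^ 2 * R' ^ 2)) * 4 := by
            rw [← ENNReal.ofReal_ofNat 4, ← ENNReal.ofReal_mul' (by norm_num)]
            congr 1
            ring
          rw [ENNReal.ofReal_add (by positivity) (by positivity), h12]
          ring
      _ ≤ ENNReal.ofReal K₃ * B₂ + ENNReal.ofReal K₃ * B₁ := by
          refine add_le_add (mul_le_mul' ?_ le_rfl) (mul_le_mul' (ENNReal.ofReal_le_ofReal ?_) le_rfl)
          · rw [← ENNReal.ofReal_ofNat 3]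
            exact ENNReal.ofReal_le_ofReal (by rw [hK₃]; nlinarith [sq_nonneg C, sq_nonneg (C * R')])
          · rw [hK₃]; linarith
      _ = ENNReal.ofReal K₃ * (B₁ + B₂) := by ring
  -- finiteness and the a priori bounds for `Φ`
  have hI₁top : (∫⁻ z in S, ENNReal.ofReal (‖fderiv ℝ Φ z‖ ^ 2)) < ⊤ :=
    hI₁.trans_lt (ENNReal.mul_lt_top ENNReal.ofReal_lt_top hB₁top)
  have hI₂top : (∫⁻ z in S, ENNReal.ofReal (‖fderiv ℝ (fderiv ℝ Φ) z‖ ^ 2)) < ⊤ :=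
    hI₂.trans_lt (ENNReal.mul_lt_top ENNReal.ofReal_lt_top (ENNReal.add_lt_top.mpr ⟨hB₁top, hB₂top⟩))
  have hdecΦ : ∃ C' : ℝ, ∀ z ∈ S, ‖z‖ * |Φ z| ≤ C' ∧ ‖z‖ * ‖fderiv ℝ Φ z‖ ≤ C' := by
    refine ⟨|C₀| + |C₀| * C, fun z hz ↦ ⟨?_, ?_⟩⟩
    · calc ‖z‖ * |Φ z| = |χ z| * (‖z‖ * |g z|) := by rw [hΦ]; simp only [abs_mul]; ring
        _ ≤ 1 * |C₀| := by
            refine mul_le_mul ?_ ((hC₀ z hz).1.trans (le_abs_self _)) (by positivity) zero_le_one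
            rw [abs_of_nonneg (hχnn z)]; exact hχ1 z
        _ ≤ |C₀| + |C₀| * C := by nlinarith [abs_nonneg C₀]
    · by_cases hzR : ‖z‖ < R₁
      · have h1 := norm_fderiv_mul_le hSo hχs hg hz
        calc ‖z‖ * ‖fderiv ℝ Φ z‖
            ≤ ‖z‖ * (|χ z| * ‖fderiv ℝ g z‖ + |g z| * ‖fderiv ℝ χ z‖) :=
              mul_le_mul_of_nonneg_left h1 (norm_nonneg _)
          _ = |χ z| * (‖z‖ * ‖fderiv ℝ g z‖) + (‖z‖ * |g z|) * ‖fderiv ℝ χ z‖ := by ring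
          _ ≤ 1 * |C₀| + |C₀| * C := by
              refine add_le_add (mul_le_mul ?_ (((hC₀ z hz).2 hzR).trans (le_abs_self _))
                (by positivity) zero_le_one)
                (mul_le_mul ((hC₀ z hz).1.trans (le_abs_self _)) (hDχ z) (norm_nonneg _)
                  (abs_nonneg _))
              rw [abs_of_nonneg (hχnn z)]; exact hχ1 z
          _ = |C₀| + |C₀| * C := by ring
      · -- beyond `R₁` the product vanishes identically near `z`
        have hzR' : R₁ - 1 / 2 < ‖z‖ := by linarith [not_lt.mp hzR]
        have hev : Φ =ᶠ[𝓝 z] fun _ ↦ (0 : ℝ) := by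
          have hopen : IsOpen {w : E3 | R₁ - 1 / 2 < ‖w‖} := isOpen_lt continuous_const continuous_norm
          filter_upwards [hopen.mem_nhds hzR'] with w hw
          simp [hΦ, hχzero w (le_of_lt hw)]
        rw [hev.fderiv_eq, (hasFDerivAt_const (𝕜 := ℝ) (0 : ℝ) z).fderiv, norm_zero, mul_zero]
        positivity
  -- Agmon for `Φ`, and `Φ y = g y`
  have hGNy := hGN Φ hΦreg hdecΦ hI₁top hI₂top y hyS
  have hΦy : Φ y = g y := by simp [hΦ, hχone y hyR]
  rw [hΦy] at hGNy
  -- the real-number bookkeeping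
  set b₁ : ℝ := B₁.toReal with hb₁
  set b₁₂ : ℝ := (B₁ + B₂).toReal with hb₁₂
  have hb₁nn : 0 ≤ b₁ := ENNReal.toReal_nonneg
  have hb₁₂nn : 0 ≤ b₁₂ := ENNReal.toReal_nonneg
  have hB₁₂top : B₁ + B₂ ≠ ⊤ := (ENNReal.add_lt_top.mpr ⟨hB₁top, hB₂top⟩).ne
  have hI₁r : (∫⁻ z in S, ENNReal.ofReal (‖fderiv ℝ Φ z‖ ^ 2)).toReal ≤ K₁ * b₁ := by
    have h := ENNReal.toReal_mono (ENNReal.mul_ne_top ENNReal.ofReal_ne_top hB₁top.ne) hI₁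
    rwa [ENNReal.toReal_mul, ENNReal.toReal_ofReal hK₁nn] at h
  have hI₂r : (∫⁻ z in S, ENNReal.ofReal (‖fderiv ℝ (fderiv ℝ Φ) z‖ ^ 2)).toReal ≤ K₃ * b₁₂ := by
    have h := ENNReal.toReal_mono (ENNReal.mul_ne_top ENNReal.ofReal_ne_top hB₁₂top) hI₂
    rwa [ENNReal.toReal_mul, ENNReal.toReal_ofReal hK₃nn] at h
  set I₁r : ℝ := (∫⁻ z in S, ENNReal.ofReal (‖fderiv ℝ Φ z‖ ^ 2)).toReal with hI₁rdef
  set I₂r : ℝ := (∫⁻ z in S, ENNReal.ofReal (‖fderiv ℝ (fderiv ℝ Φ) z‖ ^ 2)).toReal with hI₂rdef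
  have hI₁rnn : 0 ≤ I₁r := ENNReal.toReal_nonneg
  have hI₂rnn : 0 ≤ I₂r := ENNReal.toReal_nonneg
  have hs1 : Real.sqrt I₁r ≤ Real.sqrt K₁ * Real.sqrt b₁ := by
    rw [← Real.sqrt_mul hK₁nn]; exact Real.sqrt_le_sqrt hI₁r
  have hs2 : Real.sqrt I₂r ≤ Real.sqrt K₃ * Real.sqrt b₁₂ := by
    rw [← Real.sqrt_mul hK₃nn]; exact Real.sqrt_le_sqrt hI₂r
  calc g y ^ 2 ≤ Cg * (Real.sqrt I₁r * Real.sqrt I₂r + I₂r) := hGNy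
    _ ≤ Cg * ((Real.sqrt K₁ * Real.sqrt b₁) * (Real.sqrt K₃ * Real.sqrt b₁₂) + K₃ * b₁₂) := by
        gcongr
    _ = Cg * (Real.sqrt K₁ * Real.sqrt K₃) * (Real.sqrt b₁ * Real.sqrt b₁₂) + Cg * K₃ * b₁₂ := by ring
    _ ≤ Cg * (Real.sqrt K₁ * Real.sqrt K₃ + K₃) * (Real.sqrt b₁ * Real.sqrt b₁₂) +
          Cg * (Real.sqrt K₁ * Real.sqrt K₃ + K₃) * b₁₂ := by
        have h1 : 0 ≤ Real.sqrt b₁ * Real.sqrt b₁₂ := by positivity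
        have h2 : 0 ≤ Real.sqrt K₁ * Real.sqrt K₃ := by positivity
        gcongr
        · linarith
        · linarith
    _ = Cg * (Real.sqrt K₁ * Real.sqrt K₃ + K₃) * (Real.sqrt b₁ * Real.sqrt b₁₂ + b₁₂) := by ring

/-! ### Bookkeeping of the constants -/

/-- From the local Agmon bound with `B₁ = C₁⁺ t`, `B₂ = C₂⁺ t` to a bound `≤ K' t`. [folklore] -/
theorem localAgmon_bookkeeping {u K c₁ c₂ t : ℝ} (hc₁ : 0 ≤ c₁) (hc₂ : 0 ≤ c₂) (ht : 0 ≤ t)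
    (hu : u ^ 2 ≤ K * (Real.sqrt (ENNReal.ofReal (c₁ * t)).toReal *
      Real.sqrt (ENNReal.ofReal (c₁ * t) + ENNReal.ofReal (c₂ * t)).toReal +
      (ENNReal.ofReal (c₁ * t) + ENNReal.ofReal (c₂ * t)).toReal)) :
    u ^ 2 ≤ K * (Real.sqrt c₁ * Real.sqrt (c₁ + c₂) + (c₁ + c₂)) * t := by
  have h1 : (ENNReal.ofReal (c₁ * t)).toReal = c₁ * t := ENNReal.toReal_ofReal (mul_nonneg hc₁ ht)
  have h2 : (ENNReal.ofReal (c₁ * t) + ENNReal.ofReal (c₂ * t)).toReal = (c₁ + c₂) * t := by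
    rw [ENNReal.toReal_add ENNReal.ofReal_ne_top ENNReal.ofReal_ne_top, h1,
      ENNReal.toReal_ofReal (mul_nonneg hc₂ ht)]
    ring
  rw [h1, h2, sqrt_mul_sqrt_add_eq hc₁ (add_nonneg hc₁ hc₂) ht] at hu
  calc u ^ 2 ≤ K * ((Real.sqrt c₁ * Real.sqrt (c₁ + c₂) + (c₁ + c₂)) * t) := hu
    _ = K * (Real.sqrt c₁ * Real.sqrt (c₁ + c₂) + (c₁ + c₂)) * t := by ring

/-! ### The assembly: (31) on `Σ̃_τ(h♯_{R₁}) ∩ {‖y‖ ≤ R₁ − 1}` from (D2), (D3′) and (L3) -/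

section assembly

variable
  /- (H) = (D2) ∧ (D3′) ∧ (L3), see the module docstring. -/
  (hH : ∀ [Facts] [SliceFacts] (M a : ℝ), IsSubextremal M a →
      ∃ R₀ : ℝ, rPlus M a < R₀ ∧ ∀ R₁ : ℝ, R₀ ≤ R₁ →
        ∀ ψ : region a (rPlus M a) → ℝ, Literature.Geometry.Lorentzian.IsAdmissibleKerrWave M a ψ →
          HasBallData M a R₁ ψ →
            -- (D2) second-order leaf energy, improved decay: DRSR Cor. 3.1, second estimate /
            -- Moschidis Thm. 9.1, q = 2 (whole leaf)
            (∀ δ : ℝ, 0 < δ → ∃ C : ℝ, ∀ τ : ℝ, 1 ≤ τ →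
              leafHessEnergy M a (scriHeight M a R₁) ψ τ ≤
                ENNReal.ofReal (C * τ ^ (-4 + 2 * δ))) ∧
            -- (D3′) a priori bounds on each leaf: decay of `Ψ_τ`, `DΨ_τ` along the leaf (radiation
            -- field, Moschidis Thm. 7.1) and boundedness of the Hessian on the compact part
            (∀ τ : ℝ, 1 ≤ τ → ∃ C₀ : ℝ, ∀ y ∈ (slice a (rPlus M a) : Set E3),
              ‖y‖ * |leafFun M a (scriHeight M a R₁) ψ τ y| ≤ C₀ ∧
                ‖y‖ * ‖fderiv ℝ (leafFun M a (scriHeight M a R₁) ψ τ) y‖ ≤ C₀ ∧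
                (‖y‖ ≤ R₁ → ‖fderiv ℝ (fderiv ℝ (leafFun M a (scriHeight M a R₁) ψ τ)) y‖ ≤ C₀)) ∧
            -- (L3) local third-order improved decay: DRSR Cor. 3.1, second estimate commuted once,
            -- with Thm. 3.2 (29) at `j = 3` / Moschidis Thm. 9.1, q = 2, m = 1, on `{‖y‖ < R₁}`
            (∀ δ : ℝ, 0 < δ → ∃ C : ℝ, ∀ τ : ℝ, 1 ≤ τ →
              (∫⁻ y in (slice a (rPlus M a) : Set E3) ∩ ball (0 : E3) R₁, ENNReal.ofReal
                  (‖iteratedFDeriv ℝ 3 (leafFun M a (scriHeight M a R₁) ψ τ) y‖ ^ 2 +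
                    ‖fderiv ℝ (fderiv ℝ (leafFun M a (scriHeight M a R₁) (timeDeriv ψ) τ)) y‖ ^ 2)) ≤
                ENNReal.ofReal (C * τ ^ (-4 + 2 * δ))))

include hH

/-- **DRSR Corollary 3.1 (31) on `Σ̃_τ(h♯_{R₁}) ∩ {‖y‖ ≤ R₁ − 1}`, Cartesian leaf frame, from the
second-order leaf energy decay (D2), the a priori bounds (D3′) and the local third-order energy
decay (L3)** (hypothesis (H), module docstring): for `|a| < M` there is `R₀` such that for
`R₁ ≥ R₀`, every admissible `ψ` with data in `{‖y‖ ≤ R₁}` and every `δ > 0` there is `C` with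
`(TΨ)_τ(y)² + ‖DΨ_τ(y)‖² ≤ C τ^{-4+2δ}` for all `τ ≥ 1` and all `y ∈ S = {r(0, ·) > r₊}` with
`‖y‖ ≤ R₁ − 1` (`Ψ_τ = leafFun … ψ τ`, `(TΨ)_τ = leafFun … (timeDeriv ψ) τ`). The argument of
Moschidis, arXiv:1509.08489, §9.9 (Cor. 9.2, `m = 1`, with the cut-off to the region of interest)
on the concrete quantities: `Kerr.sq_le_of_localAgmon` for `g = (TΨ)_τ` and `g = ∂ᵢΨ_τ`
(`i = 1, 2, 3`), whose inputs are `∫_S ‖D(TΨ)_τ‖², ∫_S ‖D∂ᵢΨ_τ‖² ≤ leafHessEnergy ψ τ` ((D2)) and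
`∫_{S∩{‖y‖<R₁}} ‖D²(TΨ)_τ‖², ∫_{S∩{‖y‖<R₁}} ‖D²∂ᵢΨ_τ‖² ≤` the integral of (L3); the a priori bounds
come from (D3′) for `ψ` and for the admissible wave `Tψ` (`IsAdmissibleKerrWave.timeDeriv`,
`HasBallData.timeDeriv`). [cite: Moschidis2016, Cor. 9.2 with §9.9; DafermosRodnianskiShlapentokhrothman2014 §3.3 Cor. 3.1 (31)] -/
theorem drsr_corollary_3_1_scri_derivative_decay_of_localEnergy_decay :
    ∀ [Facts] [SliceFacts] (M a : ℝ), IsSubextremal M a →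
      ∃ R₀ : ℝ, rPlus M a < R₀ ∧ ∀ R₁ : ℝ, R₀ ≤ R₁ →
        ∀ ψ : region a (rPlus M a) → ℝ, Literature.Geometry.Lorentzian.IsAdmissibleKerrWave M a ψ →
          HasBallData M a R₁ ψ → ∀ δ : ℝ, 0 < δ →
            ∃ C : ℝ, ∀ τ : ℝ, 1 ≤ τ → ∀ y ∈ (slice a (rPlus M a) : Set E3), ‖y‖ ≤ R₁ - 1 →
              (leafFun M a (scriHeight M a R₁) (timeDeriv ψ) τ y) ^ 2 +
                  ‖fderiv ℝ (leafFun M a (scriHeight M a R₁) ψ τ) y‖ ^ 2 ≤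
                C * τ ^ (-4 + 2 * δ) := by
  intro _ _ M a hMa
  obtain ⟨R₀, hR₀, hHψ⟩ := hH M a hMa
  refine ⟨max R₀ (afRadius a (rPlus M a) + 2), lt_max_of_lt_left hR₀,
    fun R₁ hR₁ ψ hψ hball δ hδ ↦ ?_⟩
  have hR₀₁ : R₀ ≤ R₁ := (le_max_left _ _).trans hR₁
  have hRaf : afRadius a (rPlus M a) + 2 ≤ R₁ := (le_max_right _ _).trans hR₁
  have hR₁' : rPlus M a < R₁ := hR₀.trans_le hR₀₁
  have hR₁pos : 0 < R₁ := by linarith [afRadius_pos a (rPlus M a)]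
  have hM : 0 ≤ M := hMa.pos.le
  -- `Tψ` is admissible with data in the same ball
  have hTψ : Literature.Geometry.Lorentzian.IsAdmissibleKerrWave M a (timeDeriv ψ) :=
    hψ.timeDeriv hM
  have hballT : HasBallData M a R₁ (timeDeriv ψ) := HasBallData.timeDeriv hM hψ hball
  obtain ⟨hD2, hD3, hL3⟩ := hHψ R₁ hR₀₁ ψ hψ hball
  obtain ⟨-, hD3T, -⟩ := hHψ R₁ hR₀₁ (timeDeriv ψ) hTψ hballT
  obtain ⟨C₂, hC₂⟩ := hD2 δ hδ
  obtain ⟨CL, hCL⟩ := hL3 δ hδ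
  obtain ⟨K, hK, hcore⟩ := sq_le_of_localAgmon M a hMa R₁ hRaf
  -- the constants (`C⁺ = max C 0`)
  set c₂ : ℝ := max C₂ 0 with hc₂
  set cL : ℝ := max CL 0 with hcL
  have hc₂nn : 0 ≤ c₂ := le_max_right _ _
  have hcLnn : 0 ≤ cL := le_max_right _ _
  set K' : ℝ := K * (Real.sqrt c₂ * Real.sqrt (c₂ + cL) + (c₂ + cL)) with hK'
  refine ⟨K' + 3 * K', fun τ hτ y hyS hyR ↦ ?_⟩
  have hτ0 : 0 ≤ τ := zero_le_one.trans hτ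
  set t : ℝ := τ ^ (-4 + 2 * δ) with ht
  have htnn : 0 ≤ t := Real.rpow_nonneg hτ0 _
  have hSo : IsOpen (slice a (rPlus M a) : Set E3) := (slice a (rPlus M a)).isOpen
  have hSm : MeasurableSet (slice a (rPlus M a) : Set E3) := hSo.measurableSet
  have hSbm : MeasurableSet ((slice a (rPlus M a) : Set E3) ∩ ball (0 : E3) R₁) :=
    hSm.inter measurableSet_ball
  set Ψ : E3 → ℝ := leafFun M a (scriHeight M a R₁) ψ τ with hΨ
  set ΨT : E3 → ℝ := leafFun M a (scriHeight M a R₁) (timeDeriv ψ) τ with hΨT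
  have hΨs : ∀ z ∈ (slice a (rPlus M a) : Set E3), ContDiffAt ℝ ∞ Ψ z := fun z hz ↦
    leafFun_contDiffAt hMa hR₁' hψ.1 τ hz
  have hΨreg : ContDiffOn ℝ ∞ Ψ (slice a (rPlus M a) : Set E3) := leafFun_contDiffOn hMa hR₁' hψ.1 τ
  have hΨTreg : ContDiffOn ℝ ∞ ΨT (slice a (rPlus M a) : Set E3) :=
    leafFun_contDiffOn hMa hR₁' hTψ.1 τ
  -- the two energy bounds at time `τ`, with nonnegative constants
  have hHess : leafHessEnergy M a (scriHeight M a R₁) ψ τ ≤ ENNReal.ofReal (c₂ * t) :=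
    (hC₂ τ hτ).trans (ENNReal.ofReal_le_ofReal (mul_le_mul_of_nonneg_right (le_max_left _ _) htnn))
  have hLoc : (∫⁻ z in (slice a (rPlus M a) : Set E3) ∩ ball (0 : E3) R₁, ENNReal.ofReal
      (‖iteratedFDeriv ℝ 3 Ψ z‖ ^ 2 + ‖fderiv ℝ (fderiv ℝ ΨT) z‖ ^ 2)) ≤ ENNReal.ofReal (cL * t) :=
    (hCL τ hτ).trans (ENNReal.ofReal_le_ofReal (mul_le_mul_of_nonneg_right (le_max_left _ _) htnn))
  -- the time derivative: the core for `g = (TΨ)_τ`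
  have hT : ΨT y ^ 2 ≤ K' * t := by
    have hdec : ∃ C₀ : ℝ, ∀ z ∈ (slice a (rPlus M a) : Set E3),
        ‖z‖ * |ΨT z| ≤ C₀ ∧ (‖z‖ < R₁ → ‖z‖ * ‖fderiv ℝ ΨT z‖ ≤ C₀) := by
      obtain ⟨C₀, hC₀⟩ := hD3T τ hτ
      exact ⟨C₀, fun z hz ↦ ⟨(hC₀ z hz).1, fun _ ↦ (hC₀ z hz).2.1⟩⟩
    have hB₁ : (∫⁻ z in (slice a (rPlus M a) : Set E3), ENNReal.ofReal (‖fderiv ℝ ΨT z‖ ^ 2)) ≤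
        ENNReal.ofReal (c₂ * t) :=
      (lintegral_fderiv_timeDeriv_sq_le_leafHessEnergy M a _ ψ τ).trans hHess
    have hB₂ : (∫⁻ z in (slice a (rPlus M a) : Set E3) ∩ ball (0 : E3) R₁,
        ENNReal.ofReal (‖fderiv ℝ (fderiv ℝ ΨT) z‖ ^ 2)) ≤ ENNReal.ofReal (cL * t) := by
      refine le_trans (setLIntegral_mono' hSbm fun z _ ↦ ENNReal.ofReal_le_ofReal ?_) hLoc
      exact le_add_of_nonneg_left (sq_nonneg _)
    have h := hcore ΨT hΨTreg hdec _ _ hB₁ hB₂ ENNReal.ofReal_lt_top ENNReal.ofReal_lt_top y hyS hyR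
    exact localAgmon_bookkeeping hc₂nn hcLnn htnn h
  -- the spatial partial derivatives: the core for `g = ∂ᵢΨ_τ`
  have hS : ∀ i : Fin 3, (fderiv ℝ Ψ y (EuclideanSpace.single i (1 : ℝ))) ^ 2 ≤ K' * t := by
    intro i
    set v : E3 := EuclideanSpace.single i (1 : ℝ) with hv
    have hv1 : ‖v‖ = 1 := by rw [hv]; simp
    set Φ : E3 → ℝ := fun z ↦ fderiv ℝ Ψ z v with hΦ
    have hreg : ContDiffOn ℝ ∞ Φ (slice a (rPlus M a) : Set E3) := fun z hz ↦
      (contDiffAt_partial_infty (hΨs z hz) v).contDiffWithinAt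
    -- pointwise domination on `S`
    have hd0 : ∀ z ∈ (slice a (rPlus M a) : Set E3), |Φ z| ≤ ‖fderiv ℝ Ψ z‖ := fun z _ ↦ by
      simpa [hv1] using abs_partial_le Ψ z v
    have hd1 : ∀ z ∈ (slice a (rPlus M a) : Set E3),
        ‖fderiv ℝ Φ z‖ ≤ ‖fderiv ℝ (fderiv ℝ Ψ) z‖ := fun z hz ↦ by
      simpa [hv1] using norm_fderiv_partial_le (hΨs z hz) v
    have hd2 : ∀ z ∈ (slice a (rPlus M a) : Set E3),
        ‖fderiv ℝ (fderiv ℝ Φ) z‖ ≤ ‖iteratedFDeriv ℝ 3 Ψ z‖ := fun z hz ↦ by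
      simpa [hv1] using norm_fderiv_fderiv_partial_le (hΨs z hz) v
    -- a priori bounds from (D3′)
    have hdec : ∃ C₀ : ℝ, ∀ z ∈ (slice a (rPlus M a) : Set E3),
        ‖z‖ * |Φ z| ≤ C₀ ∧ (‖z‖ < R₁ → ‖z‖ * ‖fderiv ℝ Φ z‖ ≤ C₀) := by
      obtain ⟨C₀, hC₀⟩ := hD3 τ hτ
      refine ⟨max C₀ (R₁ * C₀), fun z hz ↦ ⟨?_, fun hzR ↦ ?_⟩⟩
      · calc ‖z‖ * |Φ z| ≤ ‖z‖ * ‖fderiv ℝ Ψ z‖ :=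
              mul_le_mul_of_nonneg_left (hd0 z hz) (norm_nonneg _)
          _ ≤ max C₀ (R₁ * C₀) := ((hC₀ z hz).2.1).trans (le_max_left _ _)
      · have h2 : ‖fderiv ℝ (fderiv ℝ Ψ) z‖ ≤ C₀ := (hC₀ z hz).2.2 hzR.le
        have hC₀nn : 0 ≤ C₀ := (ContinuousLinearMap.opNorm_nonneg _).trans h2
        calc ‖z‖ * ‖fderiv ℝ Φ z‖ ≤ ‖z‖ * ‖fderiv ℝ (fderiv ℝ Ψ) z‖ :=
              mul_le_mul_of_nonneg_left (hd1 z hz) (norm_nonneg _)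
          _ ≤ R₁ * C₀ := mul_le_mul hzR.le h2 (ContinuousLinearMap.opNorm_nonneg _) hR₁pos.le
          _ ≤ max C₀ (R₁ * C₀) := le_max_right _ _
    -- the two integrals
    have hB₁ : (∫⁻ z in (slice a (rPlus M a) : Set E3), ENNReal.ofReal (‖fderiv ℝ Φ z‖ ^ 2)) ≤
        ENNReal.ofReal (c₂ * t) := by
      refine le_trans ?_ ((lintegral_fderiv_fderiv_sq_le_leafHessEnergy M a _ ψ τ).trans hHess)
      exact setLIntegral_mono' hSm fun z hz ↦
        ENNReal.ofReal_le_ofReal (by have h := hd1 z hz; gcongr)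
    have hB₂ : (∫⁻ z in (slice a (rPlus M a) : Set E3) ∩ ball (0 : E3) R₁,
        ENNReal.ofReal (‖fderiv ℝ (fderiv ℝ Φ) z‖ ^ 2)) ≤ ENNReal.ofReal (cL * t) := by
      refine le_trans (setLIntegral_mono' hSbm fun z hz ↦ ENNReal.ofReal_le_ofReal ?_) hLoc
      have h := hd2 z hz.1
      calc ‖fderiv ℝ (fderiv ℝ Φ) z‖ ^ 2 ≤ ‖iteratedFDeriv ℝ 3 Ψ z‖ ^ 2 :=
            pow_le_pow_left₀ (ContinuousLinearMap.opNorm_nonneg _) h 2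
        _ ≤ ‖iteratedFDeriv ℝ 3 Ψ z‖ ^ 2 + ‖fderiv ℝ (fderiv ℝ ΨT) z‖ ^ 2 :=
            le_add_of_nonneg_right (sq_nonneg _)
    have h := hcore Φ hreg hdec _ _ hB₁ hB₂ ENNReal.ofReal_lt_top ENNReal.ofReal_lt_top y hyS hyR
    exact localAgmon_bookkeeping hc₂nn hcLnn htnn h
  -- sum
  have hsum : ‖fderiv ℝ Ψ y‖ ^ 2 ≤ 3 * K' * t := by
    rw [norm_sq_eq_sum_sq_apply_single]
    calc ∑ i : Fin 3, (fderiv ℝ Ψ y (EuclideanSpace.single i (1 : ℝ))) ^ 2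
        ≤ ∑ _i : Fin 3, K' * t := Finset.sum_le_sum fun i _ ↦ hS i
      _ = 3 * K' * t := by
          rw [Finset.sum_const, Finset.card_univ, Fintype.card_fin, nsmul_eq_mul]
          push_cast
          ring
  calc ΨT y ^ 2 + ‖fderiv ℝ Ψ y‖ ^ 2 ≤ K' * t + 3 * K' * t := add_le_add hT hsum
    _ = (K' + 3 * K') * t := by ring

/-- **DRSR's pointwise derivative decay (coordinate form) from (D2), (D3′) and the local
third-order energy decay (L3)**: under hypothesis (H) (module docstring) the gr.S24 named fact
`Literature.Geometry.Lorentzian.drsr_wave_derivative_decay_kerr` (`KerrWaveDecay.lean`; DRSR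
Cor. 3.1 (31)) holds. Given an admissible `ψ` (data supported in `{‖x⃗‖ ≤ ρ}`), `δ > 0` and a
coordinate radius `R`, take `R₁ = max(R₀, ρ, |R| + 1)`: `ψ` has ball data of radius `R₁`, every
slice point `(τ, y)` with `‖y‖ ≤ R` has `‖y‖ ≤ R₁ − 1`, the height `h♯_{R₁}` vanishes near `y`, the
leaf function is the slice function `ψ̃(τ, ·)` near `y`, and
`coordEnergyDensity ψ (τ, y) = (TΨ)_τ(y)² + ‖DΨ_τ(y)‖² ≤ C τ^{-4+2δ}` by
`Kerr.drsr_corollary_3_1_scri_derivative_decay_of_localEnergy_decay`. DRSR arXiv:1402.7034,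
§3.3, Cor. 3.1 (31) and p. 51. [cite: DafermosRodnianskiShlapentokhrothman2014, Cor. 3.1 (31); Moschidis2016 Cor. 9.2] -/
theorem _root_.Literature.Geometry.Lorentzian.drsr_wave_derivative_decay_kerr_of_localEnergy_decay :
    drsr_wave_derivative_decay_kerr := by
  intro _ _ M a hMa ψ hψ δ hδ R
  obtain ⟨R₀, hR₀, hcor⟩ :=
    drsr_corollary_3_1_scri_derivative_decay_of_localEnergy_decay hH M a hMa
  -- a coordinate ball containing the support of the data
  obtain ⟨K, hK, hsupp⟩ := hψ.2.2
  obtain ⟨ρ, hρ, hKρ⟩ := exists_spatialNorm_le_of_isCompact hK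
  set R₁ : ℝ := max R₀ (max ρ (|R| + 1)) with hR₁
  have hR₀₁ : R₀ ≤ R₁ := le_max_left _ _
  have hρ₁ : ρ ≤ R₁ := (le_max_left _ _).trans (le_max_right _ _)
  have hRR₁ : |R| + 1 ≤ R₁ := (le_max_right _ _).trans (le_max_right _ _)
  have hR₁nn : 0 ≤ R₁ := hρ.trans hρ₁
  have hdata : HasBallData M a R₁ ψ := by
    intro x hx0 hxR
    refine hsupp x hx0 fun hxK ↦ ?_
    have := hKρ x hxK
    linarith
  obtain ⟨C, hC⟩ := hcor R₁ hR₀₁ ψ hψ hdata δ hδ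
  refine ⟨C, fun τ hτ y hy hyR ↦ ?_⟩
  have hyS : y ∈ (slice a (rPlus M a) : Set E3) := ofTimeSpace_mem_region_iff.1 hy
  have hyR₁ : ‖y‖ < R₁ := by
    have : ‖y‖ ≤ |R| := hyR.trans (le_abs_self R)
    linarith
  have hyR₁' : ‖y‖ ≤ R₁ - 1 := by
    have : ‖y‖ ≤ |R| := hyR.trans (le_abs_self R)
    linarith
  have hbound := hC τ hτ y hyS hyR₁'
  set h : E3 → ℝ := scriHeight M a R₁ with hh
  set Φ : E4 → ℝ := Function.extend Subtype.val ψ 0 with hΦ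
  -- on the ball `{‖y'‖ < R₁}` the leaf function is the slice function `ψ̃(τ, ·)`
  have hEq : leafFun M a h ψ τ =ᶠ[𝓝 y] fun y' ↦ Φ (E4.ofTimeSpace τ y') := by
    filter_upwards [isOpen_ball.mem_nhds (mem_ball_zero_iff.2 hyR₁)] with y' hy'
    show Function.extend Subtype.val ψ 0 (leafPoint h τ y') = Φ (E4.ofTimeSpace τ y')
    rw [leafPoint_of_eq_zero (scriHeight_eq_zero_of_norm_le hR₁nn (mem_ball_zero_iff.1 hy').le)]
  have hΦd : DifferentiableAt ℝ Φ (E4.ofTimeSpace τ y) :=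
    (contDiffAt_extend hψ.1 ⟨_, hy⟩).differentiableAt (by simp)
  have hDf : fderiv ℝ (leafFun M a h ψ τ) y =
      (fderiv ℝ Φ (E4.ofTimeSpace τ y)).comp E4.spaceEmbed := by
    rw [hEq.fderiv_eq]
    exact (hΦd.hasFDerivAt.comp y (E4.hasFDerivAt_ofTimeSpace τ y)).fderiv
  have hspatial : ∀ i : Fin 3, fderiv ℝ (leafFun M a h ψ τ) y (EuclideanSpace.single i (1 : ℝ)) =
      fderiv ℝ Φ (E4.ofTimeSpace τ y) (EuclideanSpace.single i.succ (1 : ℝ)) := fun i ↦ by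
    rw [hDf, ContinuousLinearMap.coe_comp, Function.comp_apply, E4.spaceEmbed_apply,
      E4.ofTimeSpace_zero_single]
  -- the time derivative at the slice point
  have h0 : h y = 0 := scriHeight_eq_zero_of_norm_le hR₁nn hyR₁.le
  have htime : leafFun M a h (timeDeriv ψ) τ y =
      fderiv ℝ Φ (E4.ofTimeSpace τ y) (EuclideanSpace.single 0 (1 : ℝ)) := by
    show Function.extend Subtype.val (timeDeriv ψ) 0 (leafPoint h τ y) = _
    rw [leafPoint_of_eq_zero h0]
    exact (extend_rep (timeDeriv ψ) ⟨E4.ofTimeSpace τ y, hy⟩).symm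
  -- the coordinate energy density is the sum of the squares of the four components
  have hsplit : coordEnergyDensity (exterior M a) ψ (E4.ofTimeSpace τ y) =
      (leafFun M a h (timeDeriv ψ) τ y) ^ 2 + ‖fderiv ℝ (leafFun M a h ψ τ) y‖ ^ 2 := by
    rw [norm_sq_eq_sum_sq_apply_single, htime]
    simp_rw [hspatial]
    rw [coordEnergyDensity]
    exact Fin.sum_univ_succ _
  rw [hsplit]
  exact hbound

end assembly

end Kerr

end Literature.Geometry.Lorentzian

end
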